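import Mathlib.RingTheory.DedekindDomain.Ideal.Lemmas
import Mathlib.GroupTheory.Index
import Mathlib.Analysis.SpecificLimits.Basic
import HarnessLib

/-!
# The `𝔭`-torsion point count of a `𝔭`-divisible `𝒪`-module group, and its monotonicity along equivariant homomorphisms with finite kernel
# ([GortzWedhorn2023] Prop. 27.188 (2), Def. 27.189: `X[p^m](K) = (ℤ∕p^m)^{f}`, the `p`-rank; Prop. 27.190: isogenies)

Topic `Literature/Algebra/Module`; namespace `Literature.Algebra.Module.DivisibleTorsionPointCount`.  THEOREMS ONLY (no definition, no named fact, no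
`instance`, no notation, no `sorry`).  Cell `hodgecm-mathlib` (D-0151), FLOOR 0, P6 «MOD programme» (crux hLiu418 = stmt-HodgeConjecture-24832, `--supports`,
count-neutral): generic COUNTING ORGAN of line L2 (socket `stub_DOWN` of `Cruxes/HLiu418/Lines/F0_P6a_DatumOfInputs.lean`, organ (O2) `stub_SHEETS`, conjunct (ℓ2′)
«the `c•w`-type of a special point is `θ`-invariant»): the number of `𝔭_{c•w}`-torsion points of the special fibre `A_x̄(κ̄)` — `#G₀(κ̄) ∈ {1, q}`, the ordinary ∕
local-local dichotomy of the dock — does not decrease along an `𝒪_F`-equivariant ISOGENY `A_x̄ → A_{θ x̄}` (finite kernel on points), hence is equal along the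
pair of isogenies `θ(τ)`, `θ(τ⁻¹)`.  Pure algebra, written MULTIPLICATIVELY for a bare family of commuting endomorphisms (the currency of the hom-groups
`𝟙_ ⟶ A` of group schemes and of the dock pin `hkerG₀`: `{t ∣ ∀ r ∈ 𝔭, t ≫ ι(r) = 1}`), so that the scheme-side consumer instantiates it with `φ r t := t ≫ ι(r)`.
HC_CM is proved only modulo the printed citations (2 remaining named inputs hLiu418 24832, h413 24833) until rung 0 closes; this file is generic and changes no count.

THE MATHEMATICS ([GortzWedhorn2023] Prop. 27.188 (2) ∕ Def. 27.189: for an abelian variety over a separably closed field of characteristic `p`,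
`X[p^m](K) ≅ (ℤ∕p^m)^f` for ONE `f` and all `m` — the count `|X[p^m](K)| = |X[p](K)|^m`; Prop. 27.190: an isogeny has a quasi-inverse, so the `p`-rank is an
isogeny invariant).  Let `M` be a group with a family of endomorphisms `φ : 𝒪 → End M` (`𝒪` a commutative ring) which is additive (`φ(r+s) = φ(r)·φ(s)`),
multiplicative (`φ(rs) = φ(r) ∘ φ(s)`) and unital, `𝔭 ⊂ 𝒪` an ideal and `ϖ ∈ 𝔭` an element with (H2) `𝔭 ⊆ 𝔭^{j+1} + (ϖ)` and (H3) for every `j` some `e ≡ 1 (mod 𝔭^j)`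
with `e·𝔭^{j+1} ⊆ ϖ·𝔭^j` (both hold for `ϖ ∈ 𝔭 ∖ 𝔭²`, `𝔭` a maximal ideal of a Dedekind domain: `(ϖ) = 𝔭𝔟` with `𝔟 + 𝔭 = 𝒪`, §3).  Write
`M[𝔞] = {x ∣ φ(r) x = 1 ∀ r ∈ 𝔞}` (a subgroup).  If `φ(ϖ)` is SURJECTIVE on `M` («`M` is `𝔭`-divisible»), then `φ(ϖ) : M[𝔭^{j+1}] → M[𝔭^j]` is a surjective
homomorphism with kernel `M[𝔭^{j+1} + (ϖ)] = M[𝔭]` (surjective: lift `P` to `Q₀` with `φ(ϖ)Q₀ = P`, then `Q := φ(e)Q₀ ∈ M[𝔭^{j+1}]` still maps to `P`), so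
`|M[𝔭^{j+1}]| = |M[𝔭]|·|M[𝔭^j]` and **`|M[𝔭^j]| = |M[𝔭]|^j`** (as `Nat.card`, no finiteness needed).  If `f : M → M′` is a homomorphism intertwining `φ` and `φ′`
with FINITE kernel of size `C`, then `f(M[𝔭^j]) ⊆ M′[𝔭^j]` and `|M[𝔭]|^j = |M[𝔭^j]| ≤ C·|M′[𝔭^j]| = C·|M′[𝔭]|^j` for all `j`; if `M′[𝔭]` is finite this forces
**`|M[𝔭]| ≤ |M′[𝔭]|`** (`(a∕b)^j → ∞` for `a > b ≥ 1`); with a second such homomorphism `M′ → M`, **`|M[𝔭]| = |M′[𝔭]|`**.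

* §1 `exists_subgroup_coe_eq` (the torsion set of an ideal is a subgroup), `torsion_antitone`, `torsion_sup` (`M[𝔞] ∩ M[𝔟] = M[𝔞 + 𝔟]`), `torsion_top`;
* §2 `natCard_torsion_pow_succ` (`|M[𝔭^{j+1}]| = |M[𝔭]|·|M[𝔭^j]|`), **`natCard_torsion_pow`** (`|M[𝔭^j]| = |M[𝔭]|^j`);
* §3 `exists_uniformizer_laws` — (H2)(H3) for `ϖ ∈ 𝔭 ∖ 𝔭²`, `𝔭` maximal in a Dedekind domain; `exists_mem_not_mem_sq` (such `ϖ` exists for `𝔭 ≠ ⊥`);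
* §4 **`natCard_torsion_le_of_hom`** (monotonicity along an equivariant homomorphism with finite kernel), **`natCard_torsion_eq_of_hom_of_hom`**;
* §5 DEDEKIND HEADS **`natCard_torsion_le_of_hom_dedekind`** ∕ **`natCard_torsion_eq_of_hom_of_hom_dedekind`** (hypotheses: `𝒪` Dedekind, `𝔭` maximal `≠ ⊥`,
  every `φ(r)`, `r ≠ 0`, surjective — the shape the isogenies `ι(r)` of an abelian variety over an algebraically closed field supply).

## References
* [GortzWedhorn2023] U. Görtz, T. Wedhorn, *Algebraic Geometry II* (2023) — Prop. 27.188 (2), Def. 27.189 (the `p`-rank), Prop. 27.190 (quasi-inverse of an isogeny).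
* [MumfordAV1970] D. Mumford, *Abelian Varieties* (1970) — §15 (the `p`-rank; referred to by [GortzWedhorn2023] loc. cit.).
-/

set_option autoImplicit false

namespace Literature.Algebra.Module.DivisibleTorsionPointCount

variable {M : Type*} [Group M] {O : Type*} [CommRing O]

/-! ## §1 Torsion sets of ideals under a family of endomorphisms -/

/-- **The `𝔞`-torsion set is a subgroup** (each `φ r` is an endomorphism of the group `M`). [cite: GortzWedhorn2023, Prop. 27.188 (2)] -/
theorem exists_subgroup_coe_eq (φ : O → M → M) (hmul : ∀ r x y, φ r (x * y) = φ r x * φ r y) (𝔞 : Ideal O) :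
    ∃ S : Subgroup M, (S : Set M) = {x | ∀ r ∈ 𝔞, φ r x = 1} := by
  have hone : ∀ r, φ r 1 = 1 := fun r => by
    have h := hmul r 1 1
    rw [one_mul] at h
    exact left_eq_mul.mp h
  have hmul' : ∀ {x y : M}, x ∈ {x : M | ∀ r ∈ 𝔞, φ r x = 1} → y ∈ {x : M | ∀ r ∈ 𝔞, φ r x = 1} →
      x * y ∈ {x : M | ∀ r ∈ 𝔞, φ r x = 1} := fun {x y} hx hy r hr => by
    rw [hmul, hx r hr, hy r hr, one_mul]
  have hinv' : ∀ {x : M}, x ∈ {x : M | ∀ r ∈ 𝔞, φ r x = 1} → x⁻¹ ∈ {x : M | ∀ r ∈ 𝔞, φ r x = 1} := fun {x} hx r hr => by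
    have h := hmul r x x⁻¹
    rw [mul_inv_cancel, hone, hx r hr, one_mul] at h
    exact h.symm
  exact ⟨{ carrier := {x | ∀ r ∈ 𝔞, φ r x = 1}, one_mem' := fun r _ => hone r, mul_mem' := hmul', inv_mem' := hinv' }, rfl⟩

/-- Larger ideals have smaller torsion: `𝔞 ≤ 𝔟 → M[𝔟] ⊆ M[𝔞]`. [cite: GortzWedhorn2023, Prop. 27.188 (2)] -/
theorem torsion_antitone (φ : O → M → M) {𝔞 𝔟 : Ideal O} (h : 𝔞 ≤ 𝔟) :
    {x : M | ∀ r ∈ 𝔟, φ r x = 1} ⊆ {x | ∀ r ∈ 𝔞, φ r x = 1} :=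
  fun _ hx r hr => hx r (h hr)

/-- **`M[𝔞] ∩ M[𝔟] = M[𝔞 + 𝔟]`** (additivity `φ(r + s) = φ(r)·φ(s)`; `𝔞 + 𝔟 = {a + b}`). [cite: GortzWedhorn2023, Prop. 27.188 (2)] -/
theorem torsion_sup (φ : O → M → M) (hmul : ∀ r x y, φ r (x * y) = φ r x * φ r y) (hadd : ∀ r s x, φ (r + s) x = φ r x * φ s x)
    (𝔞 𝔟 : Ideal O) :
    {x : M | ∀ r ∈ 𝔞, φ r x = 1} ∩ {x | ∀ r ∈ 𝔟, φ r x = 1} = {x | ∀ r ∈ 𝔞 ⊔ 𝔟, φ r x = 1} := by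
  have hone : ∀ r, φ r 1 = 1 := fun r => by
    have h := hmul r 1 1
    rw [one_mul] at h
    exact left_eq_mul.mp h
  ext x
  simp only [Set.mem_inter_iff, Set.mem_setOf_eq]
  constructor
  · rintro ⟨ha, hb⟩ r hr
    obtain ⟨a, ha', b, hb', rfl⟩ := Submodule.mem_sup.mp hr
    rw [hadd, ha a ha', hb b hb', one_mul]
  · intro h
    exact ⟨fun r hr => h r (Ideal.mem_sup_left hr), fun r hr => h r (Ideal.mem_sup_right hr)⟩

/-- `M[𝒪] = {1}` when `φ(1) = id`. [cite: GortzWedhorn2023, Prop. 27.188 (2)] -/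
theorem torsion_top (φ : O → M → M) (hmul : ∀ r x y, φ r (x * y) = φ r x * φ r y) (hone : ∀ x, φ 1 x = x) :
    {x : M | ∀ r ∈ (⊤ : Ideal O), φ r x = 1} = {1} := by
  have hone' : ∀ r, φ r 1 = 1 := fun r => by
    have h := hmul r 1 1
    rw [one_mul] at h
    exact left_eq_mul.mp h
  ext x
  simp only [Set.mem_setOf_eq, Set.mem_singleton_iff]
  exact ⟨fun h => by rw [← hone x]; exact h 1 Submodule.mem_top, fun h r _ => by rw [h, hone']⟩

/-! ## §2 The count `|M[𝔭^j]| = |M[𝔭]|^j` for a `𝔭`-divisible group -/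

/-- **`|M[𝔭^{j+1}]| = |M[𝔭]| · |M[𝔭^j]|**: `φ(ϖ) : M[𝔭^{j+1}] → M[𝔭^j]` is a surjective homomorphism with kernel `M[𝔭]` (hypotheses (H2) `𝔭 ≤ 𝔭^{j+1} + (ϖ)`, (H3)
`∃ e ≡ 1 (𝔭^j), e·𝔭^{j+1} ⊆ ϖ·𝔭^j`, and `φ(ϖ)` surjective on `M`); as `Nat.card`, with no finiteness assumption. [cite: GortzWedhorn2023, Prop. 27.188 (2)] -/
theorem natCard_torsion_pow_succ (φ : O → M → M) (hmul : ∀ r x y, φ r (x * y) = φ r x * φ r y) (hadd : ∀ r s x, φ (r + s) x = φ r x * φ s x)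
    (hcomp : ∀ r s x, φ (r * s) x = φ r (φ s x)) (hone : ∀ x, φ 1 x = x) (𝔭 : Ideal O) (ϖ : O) (hϖ : ϖ ∈ 𝔭) (j : ℕ)
    (h2 : 𝔭 ≤ 𝔭 ^ (j + 1) ⊔ Ideal.span {ϖ}) (h3 : ∃ e : O, e - 1 ∈ 𝔭 ^ j ∧ ∀ r ∈ 𝔭 ^ (j + 1), ∃ s ∈ 𝔭 ^ j, r * e = ϖ * s)
    (hsurj : Function.Surjective (φ ϖ)) :
    Nat.card {x : M // ∀ r ∈ 𝔭 ^ (j + 1), φ r x = 1} = Nat.card {x : M // ∀ r ∈ 𝔭, φ r x = 1} * Nat.card {x : M // ∀ r ∈ 𝔭 ^ j, φ r x = 1} := by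
  have hone' : ∀ r, φ r 1 = 1 := fun r => by
    have h := hmul r 1 1
    rw [one_mul] at h
    exact left_eq_mul.mp h
  have hcomm : ∀ r s x, φ r (φ s x) = φ s (φ r x) := fun r s x => by rw [← hcomp, mul_comm, hcomp]
  obtain ⟨S₁, hS₁⟩ := exists_subgroup_coe_eq φ hmul (𝔭 ^ (j + 1))
  obtain ⟨S₀, hS₀⟩ := exists_subgroup_coe_eq φ hmul (𝔭 ^ j)
  have memS₁ : ∀ x, x ∈ S₁ ↔ ∀ r ∈ 𝔭 ^ (j + 1), φ r x = 1 := fun x => by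
    rw [← SetLike.mem_coe, hS₁]; rfl
  have memS₀ : ∀ x, x ∈ S₀ ↔ ∀ r ∈ 𝔭 ^ j, φ r x = 1 := fun x => by
    rw [← SetLike.mem_coe, hS₀]; rfl
  -- `φ(ϖ)` maps `M[𝔭^{j+1}]` into `M[𝔭^j]` (`ϖ·𝔭^j ⊆ 𝔭^{j+1}`)
  have hmap : ∀ x, x ∈ S₁ → φ ϖ x ∈ S₀ := fun x hx => by
    rw [memS₀]
    intro r hr
    rw [← hcomp]
    exact (memS₁ x).mp hx _ (by rw [pow_succ]; exact Ideal.mul_mem_mul hr hϖ)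
  let g : S₁ →* S₀ :=
    { toFun := fun x => ⟨φ ϖ x.1, hmap x.1 x.2⟩
      map_one' := Subtype.ext (hone' ϖ)
      map_mul' := fun x y => Subtype.ext (hmul ϖ x.1 y.1) }
  -- the kernel of `g` is `M[𝔭]`
  have hker : Nat.card g.ker = Nat.card {x : M // ∀ r ∈ 𝔭, φ r x = 1} := by
    refine Nat.card_congr
      { toFun := fun x => ⟨x.1.1, fun r hr => ?_⟩
        invFun := fun y => ⟨⟨y.1, (memS₁ y.1).mpr fun r hr => y.2 r (Ideal.pow_le_self (Nat.succ_ne_zero j) hr)⟩, ?_⟩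
        left_inv := fun x => rfl
        right_inv := fun y => rfl }
    · -- `x ∈ M[𝔭^{j+1}] ∩ M[(ϖ)] = M[𝔭^{j+1} + (ϖ)] ⊆ M[𝔭]`
      have hx1 : ∀ r ∈ 𝔭 ^ (j + 1), φ r x.1.1 = 1 := (memS₁ x.1.1).mp x.1.2
      have hx2 : φ ϖ x.1.1 = 1 := congrArg Subtype.val (MonoidHom.mem_ker.mp x.2)
      obtain ⟨a, ha, b, hb, hab⟩ := Submodule.mem_sup.mp (h2 hr)
      obtain ⟨c, rfl⟩ := Ideal.mem_span_singleton'.mp hb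
      rw [← hab, hadd, hx1 a ha, one_mul, hcomp, hx2, hone']
    · exact MonoidHom.mem_ker.mpr (Subtype.ext (y.2 ϖ hϖ))
  -- `g` is surjective
  have hgsurj : Function.Surjective g := by
    intro P
    obtain ⟨Q₀, hQ₀⟩ := hsurj P.1
    obtain ⟨e, he1, he2⟩ := h3
    have hP : ∀ r ∈ 𝔭 ^ j, φ r P.1 = 1 := (memS₀ P.1).mp P.2
    refine ⟨⟨φ e Q₀, (memS₁ _).mpr fun r hr => ?_⟩, Subtype.ext ?_⟩
    · obtain ⟨s, hs, hrs⟩ := he2 r hr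
      rw [← hcomp, hrs, hcomp, hcomm, hQ₀, hP s hs]
    · change φ ϖ (φ e Q₀) = P.1
      rw [hcomm, hQ₀]
      have h : φ e P.1 = φ (e - 1) P.1 * φ 1 P.1 := by rw [← hadd, sub_add_cancel]
      rw [h, hP _ he1, one_mul, hone]
  -- count
  have h1 : Nat.card S₁ = Nat.card {x : M // ∀ r ∈ 𝔭 ^ (j + 1), φ r x = 1} :=
    Nat.card_congr (Equiv.subtypeEquivRight fun x => memS₁ x)
  have h0 : Nat.card S₀ = Nat.card {x : M // ∀ r ∈ 𝔭 ^ j, φ r x = 1} :=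
    Nat.card_congr (Equiv.subtypeEquivRight fun x => memS₀ x)
  have hrange : Nat.card g.range = Nat.card S₀ := by
    rw [MonoidHom.range_eq_top.mpr hgsurj, Subgroup.card_top]
  rw [← h1, ← h0, ← hker, ← hrange, ← Subgroup.card_mul_index g.ker, Subgroup.index_ker]

/-- **`|M[𝔭^j]| = |M[𝔭]|^j`** for a `𝔭`-divisible group (`φ(ϖ)` surjective; (H2)(H3) at every `j`; `φ(1) = id`), as `Nat.card`.
[cite: GortzWedhorn2023, Prop. 27.188 (2) and Def. 27.189] -/
theorem natCard_torsion_pow (φ : O → M → M) (hmul : ∀ r x y, φ r (x * y) = φ r x * φ r y) (hadd : ∀ r s x, φ (r + s) x = φ r x * φ s x)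
    (hcomp : ∀ r s x, φ (r * s) x = φ r (φ s x)) (hone : ∀ x, φ 1 x = x) (𝔭 : Ideal O) (ϖ : O) (hϖ : ϖ ∈ 𝔭)
    (h2 : ∀ j : ℕ, 𝔭 ≤ 𝔭 ^ (j + 1) ⊔ Ideal.span {ϖ}) (h3 : ∀ j : ℕ, ∃ e : O, e - 1 ∈ 𝔭 ^ j ∧ ∀ r ∈ 𝔭 ^ (j + 1), ∃ s ∈ 𝔭 ^ j, r * e = ϖ * s)
    (hsurj : Function.Surjective (φ ϖ)) (j : ℕ) :
    Nat.card {x : M // ∀ r ∈ 𝔭 ^ j, φ r x = 1} = Nat.card {x : M // ∀ r ∈ 𝔭, φ r x = 1} ^ j := by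
  induction j with
  | zero =>
    rw [pow_zero, pow_zero, Ideal.one_eq_top]
    have h : {x : M | ∀ r ∈ (⊤ : Ideal O), φ r x = 1} = {1} := torsion_top φ hmul hone
    have e : {x : M // ∀ r ∈ (⊤ : Ideal O), φ r x = 1} ≃ (({1} : Set M) : Type _) := Equiv.setCongr h
    rw [Nat.card_congr e, Nat.card_unique]
  | succ j ih =>
    rw [natCard_torsion_pow_succ φ hmul hadd hcomp hone 𝔭 ϖ hϖ j (h2 j) (h3 j) hsurj, ih, pow_succ, mul_comm]

/-! ## §3 The laws (H2)(H3) for a uniformizer of a maximal ideal of a Dedekind domain -/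

/-- **(H2)(H3) hold for `ϖ ∈ 𝔭 ∖ 𝔭²`, `𝔭` maximal in a Dedekind domain**: `(ϖ) = 𝔭·𝔟` with `𝔭 ∤ 𝔟`, so `𝔟 + 𝔭^j = 𝒪`; then `𝔭^{j+1} + (ϖ) ⊇ 𝔭(𝔭^j + 𝔟) = 𝔭`, and
`e ∈ 𝔟` with `e ≡ 1 (𝔭^j)` has `e·𝔭^{j+1} ⊆ 𝔟𝔭^{j+1} = ϖ·𝔭^j`. [cite: GortzWedhorn2023, Prop. 27.188 (2)] -/
theorem exists_uniformizer_laws [IsDedekindDomain O] (𝔭 : Ideal O) [𝔭.IsMaximal] (ϖ : O) (hϖ : ϖ ∈ 𝔭) (hϖ2 : ϖ ∉ 𝔭 ^ 2) (j : ℕ) :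
    𝔭 ≤ 𝔭 ^ (j + 1) ⊔ Ideal.span {ϖ} ∧ ∃ e : O, e - 1 ∈ 𝔭 ^ j ∧ ∀ r ∈ 𝔭 ^ (j + 1), ∃ s ∈ 𝔭 ^ j, r * e = ϖ * s := by
  -- `(ϖ) = 𝔭 · 𝔟` with `𝔭 ∤ 𝔟`
  obtain ⟨𝔟, h𝔟⟩ : 𝔭 ∣ Ideal.span {ϖ} := (Ideal.dvd_span_singleton).mpr hϖ
  have hnd : ¬ 𝔭 ∣ 𝔟 := by
    rintro ⟨𝔠, rfl⟩
    apply hϖ2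
    have : Ideal.span {ϖ} ≤ 𝔭 ^ 2 := by
      rw [h𝔟, ← mul_assoc, ← pow_two]
      exact Ideal.mul_le_right
    exact this (Ideal.mem_span_singleton_self ϖ)
  -- `𝔭^j + 𝔟 = ⊤`
  have hcop : ∀ i : ℕ, 𝔭 ^ i ⊔ 𝔟 = ⊤ := by
    intro i
    have hsup : 𝔭 ⊔ 𝔟 = ⊤ := by
      by_contra h
      have h' : 𝔭 = 𝔭 ⊔ 𝔟 := Ideal.IsMaximal.eq_of_le inferInstance h le_sup_left
      exact hnd (Ideal.dvd_iff_le.mpr (h'.symm ▸ le_sup_right))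
    exact Ideal.pow_sup_eq_top hsup
  refine ⟨?_, ?_⟩
  · -- (H2)
    calc 𝔭 = 𝔭 * (𝔭 ^ j ⊔ 𝔟) := by rw [hcop j, Ideal.mul_top]
      _ = 𝔭 ^ (j + 1) ⊔ 𝔭 * 𝔟 := by rw [Ideal.mul_sup, ← pow_succ']
      _ = 𝔭 ^ (j + 1) ⊔ Ideal.span {ϖ} := by rw [← h𝔟]
      _ ≤ 𝔭 ^ (j + 1) ⊔ Ideal.span {ϖ} := le_rfl
  · -- (H3)
    obtain ⟨u, hu, e, he, hue⟩ := Submodule.mem_sup.mp ((hcop j).symm ▸ Submodule.mem_top : (1 : O) ∈ 𝔭 ^ j ⊔ 𝔟)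
    refine ⟨e, ?_, fun r hr => ?_⟩
    · have : e - 1 = -u := by rw [← hue]; ring
      rw [this]
      exact neg_mem hu
    · have hmem : r * e ∈ Ideal.span {ϖ} * 𝔭 ^ j := by
        have h1 : r * e ∈ 𝔭 ^ (j + 1) * 𝔟 := Ideal.mul_mem_mul hr he
        rw [pow_succ, mul_assoc, ← h𝔟, mul_comm] at h1
        exact h1
      obtain ⟨s, hs, hse⟩ := Ideal.mem_span_singleton_mul.mp hmem
      exact ⟨s, hs, hse.symm⟩

/-- A nonzero ideal of a Dedekind domain that is not the unit ideal has an element outside its square (`𝔭² < 𝔭`). [cite: GortzWedhorn2023, Prop. 27.188 (2)] -/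
theorem exists_mem_not_mem_sq [IsDedekindDomain O] (𝔭 : Ideal O) (h0 : 𝔭 ≠ ⊥) (h1 : 𝔭 ≠ ⊤) : ∃ ϖ ∈ 𝔭, ϖ ∉ 𝔭 ^ 2 := by
  have hlt : 𝔭 ^ 2 < 𝔭 := by
    have h := Ideal.pow_right_strictAnti 𝔭 h0 h1 (show 1 < 2 by norm_num)
    simp only [pow_one] at h
    exact h
  obtain ⟨ϖ, hϖ, hϖ2⟩ := SetLike.exists_of_lt hlt
  exact ⟨ϖ, hϖ, hϖ2⟩

/-! ## §4 Monotonicity of the `𝔭`-torsion count along an equivariant homomorphism with finite kernel -/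

/-- Elementary: if `a^j ≤ C · b^j` for all `j` and `1 ≤ b`, then `a ≤ b` (`(a∕b)^j → ∞` for `a > b`). [folklore] -/
private theorem le_of_pow_le_mul_pow {a b C : ℕ} (hb : 1 ≤ b) (h : ∀ j : ℕ, a ^ j ≤ C * b ^ j) : a ≤ b := by
  by_contra hab
  rw [not_le] at hab
  have hbpos : (0 : ℝ) < b := by exact_mod_cast hb
  have hr : (1 : ℝ) < (a : ℝ) / b := by
    rw [one_lt_div hbpos]
    exact_mod_cast hab
  obtain ⟨j, hj⟩ := ((tendsto_pow_atTop_atTop_of_one_lt hr).eventually (Filter.eventually_gt_atTop (C : ℝ))).exists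
  have h' : ((a : ℝ) / b) ^ j ≤ C := by
    rw [div_pow, div_le_iff₀ (pow_pos hbpos j)]
    exact_mod_cast h j
  exact absurd hj (not_lt.mpr h')

/-- **MONOTONICITY ALONG AN EQUIVARIANT HOMOMORPHISM WITH FINITE KERNEL.**  `M`, `M′` groups with additive, multiplicative, unital families of endomorphisms
`φ`, `φ′ : 𝒪 → End`, `𝔭` an ideal and `ϖ ∈ 𝔭` with (H2)(H3), `φ(ϖ)` and `φ′(ϖ)` surjective, `M′[𝔭]` FINITE; `f : M →* M′` with `f(φ(r) x) = φ′(r)(f x)` and FINITE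
kernel.  Then `|M[𝔭]| ≤ |M′[𝔭]|` (`|M[𝔭]|^j = |M[𝔭^j]| ≤ |ker f| · |M′[𝔭^j]| = |ker f| · |M′[𝔭]|^j`, §2 twice and `le_of_pow_le_mul_pow`).
[cite: GortzWedhorn2023, Prop. 27.188 (2), Def. 27.189 and Prop. 27.190] -/
theorem natCard_torsion_le_of_hom {M' : Type*} [Group M'] (φ : O → M → M) (φ' : O → M' → M')
    (hmul : ∀ r x y, φ r (x * y) = φ r x * φ r y) (hadd : ∀ r s x, φ (r + s) x = φ r x * φ s x)
    (hcomp : ∀ r s x, φ (r * s) x = φ r (φ s x)) (hone : ∀ x, φ 1 x = x)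
    (hmul' : ∀ r x y, φ' r (x * y) = φ' r x * φ' r y) (hadd' : ∀ r s x, φ' (r + s) x = φ' r x * φ' s x)
    (hcomp' : ∀ r s x, φ' (r * s) x = φ' r (φ' s x)) (hone' : ∀ x, φ' 1 x = x)
    (𝔭 : Ideal O) (ϖ : O) (hϖ : ϖ ∈ 𝔭)
    (h2 : ∀ j : ℕ, 𝔭 ≤ 𝔭 ^ (j + 1) ⊔ Ideal.span {ϖ}) (h3 : ∀ j : ℕ, ∃ e : O, e - 1 ∈ 𝔭 ^ j ∧ ∀ r ∈ 𝔭 ^ (j + 1), ∃ s ∈ 𝔭 ^ j, r * e = ϖ * s)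
    (hsurj : Function.Surjective (φ ϖ)) (hsurj' : Function.Surjective (φ' ϖ))
    (hfin' : {x : M' | ∀ r ∈ 𝔭, φ' r x = 1}.Finite)
    (f : M →* M') (hf : ∀ r x, f (φ r x) = φ' r (f x)) (hker : (f.ker : Set M).Finite) :
    Nat.card {x : M // ∀ r ∈ 𝔭, φ r x = 1} ≤ Nat.card {x : M' // ∀ r ∈ 𝔭, φ' r x = 1} := by
  haveI : Finite {x : M' // ∀ r ∈ 𝔭, φ' r x = 1} := hfin'
  haveI : Finite f.ker := hker
  have hb : 1 ≤ Nat.card {x : M' // ∀ r ∈ 𝔭, φ' r x = 1} := by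
    have hone'' : ∀ r, φ' r 1 = 1 := fun r => by
      have h := hmul' r 1 1
      rw [one_mul] at h
      exact left_eq_mul.mp h
    haveI : Nonempty {x : M' // ∀ r ∈ 𝔭, φ' r x = 1} := ⟨⟨1, fun r _ => hone'' r⟩⟩
    exact Nat.one_le_iff_ne_zero.mpr Nat.card_pos.ne'
  refine le_of_pow_le_mul_pow (C := Nat.card f.ker) hb fun j => ?_
  rw [← natCard_torsion_pow φ hmul hadd hcomp hone 𝔭 ϖ hϖ h2 h3 hsurj j,
    ← natCard_torsion_pow φ' hmul' hadd' hcomp' hone' 𝔭 ϖ hϖ h2 h3 hsurj' j]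
  -- `M[𝔭^j]` as a subgroup and `f` restricted to it
  obtain ⟨S, hS⟩ := exists_subgroup_coe_eq φ hmul (𝔭 ^ j)
  have memS : ∀ x, x ∈ S ↔ ∀ r ∈ 𝔭 ^ j, φ r x = 1 := fun x => by
    rw [← SetLike.mem_coe, hS]; rfl
  have hfinj : Finite {x : M' // ∀ r ∈ 𝔭 ^ j, φ' r x = 1} := by
    apply Nat.finite_of_card_ne_zero
    rw [natCard_torsion_pow φ' hmul' hadd' hcomp' hone' 𝔭 ϖ hϖ h2 h3 hsurj' j]
    exact pow_ne_zero j (Nat.one_le_iff_ne_zero.mp hb)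
  let g : S →* M' := f.comp S.subtype
  -- `|S| = |ker g| · |range g|`, `ker g ↪ ker f`, `range g ↪ M′[𝔭^j]`
  have h1 : Nat.card g.ker ≤ Nat.card f.ker :=
    Nat.card_le_card_of_injective (fun x => (⟨x.1.1, by
      have hx := x.2
      rw [MonoidHom.mem_ker] at hx ⊢
      exact hx⟩ : f.ker)) (fun x y hxy => Subtype.ext (Subtype.ext (congrArg (fun z : f.ker => z.1) hxy)))
  have h2' : Nat.card g.range ≤ Nat.card {x : M' // ∀ r ∈ 𝔭 ^ j, φ' r x = 1} := by
    haveI := hfinj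
    refine Nat.card_le_card_of_injective (fun y => (⟨y.1, ?_⟩ : {x : M' // ∀ r ∈ 𝔭 ^ j, φ' r x = 1}))
      (fun y z hyz => Subtype.ext (by simpa using congrArg Subtype.val hyz))
    obtain ⟨x, hx⟩ := MonoidHom.mem_range.mp y.2
    intro r hr
    rw [← hx]
    change φ' r (f x.1) = 1
    rw [← hf, (memS x.1).mp x.2 r hr, map_one]
  calc Nat.card {x : M // ∀ r ∈ 𝔭 ^ j, φ r x = 1} = Nat.card S := Nat.card_congr (Equiv.subtypeEquivRight fun x => (memS x).symm)
    _ = Nat.card g.ker * g.ker.index := (Subgroup.card_mul_index g.ker).symm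
    _ = Nat.card g.ker * Nat.card g.range := by rw [Subgroup.index_ker]
    _ ≤ Nat.card f.ker * Nat.card {x : M' // ∀ r ∈ 𝔭 ^ j, φ' r x = 1} := Nat.mul_le_mul h1 h2'

/-- **EQUALITY ALONG A PAIR OF EQUIVARIANT HOMOMORPHISMS WITH FINITE KERNELS** (both torsion sets finite). [cite: GortzWedhorn2023, Prop. 27.188 (2), Def. 27.189 and Prop. 27.190] -/
theorem natCard_torsion_eq_of_hom_of_hom {M' : Type*} [Group M'] (φ : O → M → M) (φ' : O → M' → M')
    (hmul : ∀ r x y, φ r (x * y) = φ r x * φ r y) (hadd : ∀ r s x, φ (r + s) x = φ r x * φ s x)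
    (hcomp : ∀ r s x, φ (r * s) x = φ r (φ s x)) (hone : ∀ x, φ 1 x = x)
    (hmul' : ∀ r x y, φ' r (x * y) = φ' r x * φ' r y) (hadd' : ∀ r s x, φ' (r + s) x = φ' r x * φ' s x)
    (hcomp' : ∀ r s x, φ' (r * s) x = φ' r (φ' s x)) (hone' : ∀ x, φ' 1 x = x)
    (𝔭 : Ideal O) (ϖ : O) (hϖ : ϖ ∈ 𝔭)
    (h2 : ∀ j : ℕ, 𝔭 ≤ 𝔭 ^ (j + 1) ⊔ Ideal.span {ϖ}) (h3 : ∀ j : ℕ, ∃ e : O, e - 1 ∈ 𝔭 ^ j ∧ ∀ r ∈ 𝔭 ^ (j + 1), ∃ s ∈ 𝔭 ^ j, r * e = ϖ * s)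
    (hsurj : Function.Surjective (φ ϖ)) (hsurj' : Function.Surjective (φ' ϖ))
    (hfin : {x : M | ∀ r ∈ 𝔭, φ r x = 1}.Finite) (hfin' : {x : M' | ∀ r ∈ 𝔭, φ' r x = 1}.Finite)
    (f : M →* M') (hf : ∀ r x, f (φ r x) = φ' r (f x)) (hker : (f.ker : Set M).Finite)
    (f' : M' →* M) (hf' : ∀ r x, f' (φ' r x) = φ r (f' x)) (hker' : (f'.ker : Set M').Finite) :
    Nat.card {x : M // ∀ r ∈ 𝔭, φ r x = 1} = Nat.card {x : M' // ∀ r ∈ 𝔭, φ' r x = 1} :=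
  le_antisymm
    (natCard_torsion_le_of_hom φ φ' hmul hadd hcomp hone hmul' hadd' hcomp' hone' 𝔭 ϖ hϖ h2 h3 hsurj hsurj' hfin' f hf hker)
    (natCard_torsion_le_of_hom φ' φ hmul' hadd' hcomp' hone' hmul hadd hcomp hone 𝔭 ϖ hϖ h2 h3 hsurj' hsurj hfin f' hf' hker')

/-! ## §5 Dedekind heads: `𝒪` Dedekind, `𝔭` maximal, all `φ(r)` (`r ≠ 0`) surjective -/

/-- **DEDEKIND HEAD, monotone form.**  `𝒪` a Dedekind domain, `𝔭 ≠ ⊥` a maximal ideal; `M`, `M′` groups with additive multiplicative unital families of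
endomorphisms `φ`, `φ′` such that `φ(r)`, `φ′(r)` are SURJECTIVE for every `r ≠ 0` (isogenies on points over an algebraically closed field) and `M′[𝔭]` is
finite; `f : M →* M′` equivariant with finite kernel.  Then `|M[𝔭]| ≤ |M′[𝔭]|`. [cite: GortzWedhorn2023, Prop. 27.188 (2), Def. 27.189 and Prop. 27.190] -/
theorem natCard_torsion_le_of_hom_dedekind [IsDedekindDomain O] {M' : Type*} [Group M'] (φ : O → M → M) (φ' : O → M' → M')
    (hmul : ∀ r x y, φ r (x * y) = φ r x * φ r y) (hadd : ∀ r s x, φ (r + s) x = φ r x * φ s x)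
    (hcomp : ∀ r s x, φ (r * s) x = φ r (φ s x)) (hone : ∀ x, φ 1 x = x)
    (hmul' : ∀ r x y, φ' r (x * y) = φ' r x * φ' r y) (hadd' : ∀ r s x, φ' (r + s) x = φ' r x * φ' s x)
    (hcomp' : ∀ r s x, φ' (r * s) x = φ' r (φ' s x)) (hone' : ∀ x, φ' 1 x = x)
    (𝔭 : Ideal O) [𝔭.IsMaximal] (h𝔭 : 𝔭 ≠ ⊥)
    (hsurj : ∀ r : O, r ≠ 0 → Function.Surjective (φ r)) (hsurj' : ∀ r : O, r ≠ 0 → Function.Surjective (φ' r))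
    (hfin' : {x : M' | ∀ r ∈ 𝔭, φ' r x = 1}.Finite)
    (f : M →* M') (hf : ∀ r x, f (φ r x) = φ' r (f x)) (hker : (f.ker : Set M).Finite) :
    Nat.card {x : M // ∀ r ∈ 𝔭, φ r x = 1} ≤ Nat.card {x : M' // ∀ r ∈ 𝔭, φ' r x = 1} := by
  obtain ⟨ϖ, hϖ, hϖ2⟩ := exists_mem_not_mem_sq 𝔭 h𝔭 Ideal.IsMaximal.out.ne_top
  have hϖ0 : ϖ ≠ 0 := by
    rintro rfl
    exact hϖ2 (zero_mem _)
  exact natCard_torsion_le_of_hom φ φ' hmul hadd hcomp hone hmul' hadd' hcomp' hone' 𝔭 ϖ hϖ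
    (fun j => (exists_uniformizer_laws 𝔭 ϖ hϖ hϖ2 j).1) (fun j => (exists_uniformizer_laws 𝔭 ϖ hϖ hϖ2 j).2)
    (hsurj ϖ hϖ0) (hsurj' ϖ hϖ0) hfin' f hf hker

/-- **DEDEKIND HEAD, equality form** (equivariant homomorphisms with finite kernels both ways; both torsion sets finite): `|M[𝔭]| = |M′[𝔭]|`.
[cite: GortzWedhorn2023, Prop. 27.188 (2), Def. 27.189 and Prop. 27.190] -/
theorem natCard_torsion_eq_of_hom_of_hom_dedekind [IsDedekindDomain O] {M' : Type*} [Group M'] (φ : O → M → M) (φ' : O → M' → M')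
    (hmul : ∀ r x y, φ r (x * y) = φ r x * φ r y) (hadd : ∀ r s x, φ (r + s) x = φ r x * φ s x)
    (hcomp : ∀ r s x, φ (r * s) x = φ r (φ s x)) (hone : ∀ x, φ 1 x = x)
    (hmul' : ∀ r x y, φ' r (x * y) = φ' r x * φ' r y) (hadd' : ∀ r s x, φ' (r + s) x = φ' r x * φ' s x)
    (hcomp' : ∀ r s x, φ' (r * s) x = φ' r (φ' s x)) (hone' : ∀ x, φ' 1 x = x)
    (𝔭 : Ideal O) [𝔭.IsMaximal] (h𝔭 : 𝔭 ≠ ⊥)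
    (hsurj : ∀ r : O, r ≠ 0 → Function.Surjective (φ r)) (hsurj' : ∀ r : O, r ≠ 0 → Function.Surjective (φ' r))
    (hfin : {x : M | ∀ r ∈ 𝔭, φ r x = 1}.Finite) (hfin' : {x : M' | ∀ r ∈ 𝔭, φ' r x = 1}.Finite)
    (f : M →* M') (hf : ∀ r x, f (φ r x) = φ' r (f x)) (hker : (f.ker : Set M).Finite)
    (f' : M' →* M) (hf' : ∀ r x, f' (φ' r x) = φ r (f' x)) (hker' : (f'.ker : Set M').Finite) :
    Nat.card {x : M // ∀ r ∈ 𝔭, φ r x = 1} = Nat.card {x : M' // ∀ r ∈ 𝔭, φ' r x = 1} :=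
  le_antisymm
    (natCard_torsion_le_of_hom_dedekind φ φ' hmul hadd hcomp hone hmul' hadd' hcomp' hone' 𝔭 h𝔭 hsurj hsurj' hfin' f hf hker)
    (natCard_torsion_le_of_hom_dedekind φ' φ hmul' hadd' hcomp' hone' hmul hadd hcomp hone 𝔭 h𝔭 hsurj' hsurj hfin f' hf' hker')

end Literature.Algebra.Module.DivisibleTorsionPointCount
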